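import Literature.MathematicalPhysics.QuantumFieldTheory.TwistedPartitionFunctionMonotone
import Literature.MathematicalPhysics.QuantumFieldTheory.TwistedPartitionFunctionStrict
import HarnessLib

/-!
# Every non-trivial 't Hooft twist sector has STRICTLY positive free energy at `β ≠ 0`:
# `Z_z(β) < Z_1(β)` — Tomboulis's Prop. IV.1 strict clause for multi-plane twists

Topic `Literature/MathematicalPhysics/QuantumFieldTheory`; theorem-only sequel of `TwistedPartitionFunctionMonotone.lean`
(namespace `MultiTwist`: `twistZ_le_twistZ_eraseDir` — removing all twists through one direction does not decrease
`TwistedSector.twistZ`) and of `TwistedPartitionFunctionStrict.lean` (`twistedPartitionFunction_lt_untwisted_plane`: for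
ONE twisted plane, `L = 2^(n+1)`, every `β ≠ 0` and a central `z` acting by a scalar `ω ≠ 1`, `Z(z; q) < Z(1; q)` —
E. T. Tomboulis, arXiv:0707.2179, Prop. IV.1 eq. (4.6) and the sentence «Strict inequality holds in fact in (4.6) for any
nonvanishing β on any finite lattice», proved in the tree via the Tomboulis–Yaffe chain and the non-vanishing of the
plaquette expectation).

## What is proved (everything; no facts)

* `foldr_eraseDir_apply`, ★ `foldr_eraseDir_eq_mulSingle`: erasing every direction other than `μ, ν` leaves exactly
  the one-plane twist `Pi.mulSingle (μ,ν) z_{μν}`; `plaquetteTwist_mulSingle_inv`: its insertion is the tree's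
  `stackInsertion z_{μν}⁻¹ (μ,ν) (-1) (-1)`;
* ★ `twistZ_le_twistZ_foldr_eraseDir`, `twistZ_le_twistZ_mulSingle`: `Z_z ≤ Z_{mulSingle q z_q}` — every twist sector is
  dominated by each of its one-plane sectors (any compact `G`, continuous `ρ`, real `β`, `L` even);
* `twistZ_mulSingle`: dictionary `TwistedSector.twistZ ρ (mulSingle q ζ) β L = twistedPartitionFunction ρ β L ζ q`
  (corner stack `(-1,-1)` moved to `(0,0)` by `twistedPartitionFunctionAt_eq`, `Z(ζ⁻¹) = Z(ζ)` by
  `twistedPartitionFunction_inv`);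
* ★★ `twistZ_lt_twistZ_one`, `twistZ_div_lt_one`: `Z_z(β) < Z_1(β)` on `(ℤ/Lℤ)^d`, `L = 2^(n+1)`, for EVERY `β ≠ 0`, every
  compact `G`, continuous `ρ`, and every twist `z` with a plane `q` on which `ρ(z_q) = ω·1`, `|ω| = 1`, `ω ≠ 1`;
  ★★ `sun_twistZ_lt_untwisted`: `SU(N)`, `W{n} < W{0}` whenever some `n_{μν} ≠ 0` in `ℤ/N`.

HONEST FRAMING: finite symmetric torus of side `2^(n+1)` (the Tomboulis–Yaffe chain of the tree halves loops down to
the plaquette); the weak inequality `Z_z ≤ Z_1` holds for every even `L` (`twistZ_le_twistZ_one`).  Tomboulis and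
Kanazawa print the one-plane statements; the multi-plane forms are this file's (monotonicity under star-removal,
then the one-plane strict theorem).  Nothing about limits or string tensions.

## References
* E. T. Tomboulis, arXiv:0707.2179 (2007), §4 Prop. IV.1 eq. (4.6) and the sentence following it; §6 eq. (6.1).
  [Tomboulis2007Confinement]
* T. Kanazawa, Ann. Phys. 324 (2009) 1634, §2 Lemma 2 eq. (17). [Kanazawa2008]
* G. 't Hooft, Nucl. Phys. B153 (1979) 141, §2 eqs. (2.5)–(2.6). [tHooft1979Flux]
-/

open MeasureTheory Finset
open scoped BigOperators

namespace Literature.MathematicalPhysics.QuantumFieldTheory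

noncomputable section

namespace MultiTwist

open QuantumLattice

/-! ## Erasing a list of directions; reduction of a twist to one plane -/

section Erase

variable {d : ℕ} {G : Type*} [Group G]

/-- Erasing a list of directions (pointwise): the value on the plane `q` survives iff no erased direction
belongs to `q`. [cite: tHooft1979Flux, §2 eq. (2.5)] -/
theorem foldr_eraseDir_apply (l : List (Fin d)) (z : Twist d G) (q : Plane d) :
    (l.foldr eraseDir z) q = if (∃ κ ∈ l, q.1.1 = κ ∨ q.1.2 = κ) then 1 else z q := by
  classical
  induction l with
  | nil => simp
  | cons κ l ih =>
    rw [List.foldr_cons, eraseDir_apply, ih]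
    by_cases h : q.1.1 = κ ∨ q.1.2 = κ
    · rw [if_pos h, if_pos ⟨κ, by simp, h⟩]
    · rw [if_neg h]
      by_cases h' : ∃ κ' ∈ l, q.1.1 = κ' ∨ q.1.2 = κ'
      · rw [if_pos h', if_pos (by obtain ⟨κ', hm, hκ'⟩ := h'; exact ⟨κ', by simp [hm], hκ'⟩)]
      · rw [if_neg h', if_neg (by
          rintro ⟨κ', hm, hκ'⟩
          rcases List.mem_cons.1 hm with rfl | hm
          · exact h hκ'
          · exact h' ⟨κ', hm, hκ'⟩)]

/-- **Reduction to one plane**: erasing every direction other than `μ, ν` leaves exactly the twist of the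
plane `q = (μ, ν)` — the single-plane twist `Pi.mulSingle q z_q`. [cite: tHooft1979Flux, §2 eq. (2.5)] -/
theorem foldr_eraseDir_eq_mulSingle (z : Twist d G) (q : Plane d) :
    ((List.finRange d).filter (fun κ => κ ≠ q.1.1 ∧ κ ≠ q.1.2)).foldr eraseDir z = Pi.mulSingle q (z q) := by
  classical
  funext q'
  rw [foldr_eraseDir_apply]
  by_cases hq : q' = q
  · subst hq
    rw [Pi.mulSingle_eq_same, if_neg]
    rintro ⟨κ, hκ, h⟩
    rw [List.mem_filter] at hκ
    have hκ' := hκ.2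
    simp only [ne_eq, decide_eq_true_eq] at hκ'
    rcases h with h | h
    · exact hκ'.1 h.symm
    · exact hκ'.2 h.symm
  · rw [Pi.mulSingle_eq_of_ne hq, if_pos]
    -- some coordinate of `q'` lies outside `{μ, ν}`
    by_contra hne
    push Not at hne
    have hmem : ∀ κ : Fin d, κ ≠ q.1.1 → κ ≠ q.1.2 → q'.1.1 ≠ κ ∧ q'.1.2 ≠ κ := fun κ h1 h2 =>
      hne κ (by rw [List.mem_filter]; exact ⟨List.mem_finRange κ, by simp [h1, h2]⟩)
    have h1 : q'.1.1 = q.1.1 ∨ q'.1.1 = q.1.2 := by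
      by_contra hc
      push Not at hc
      exact (hmem q'.1.1 hc.1 hc.2).1 rfl
    have h2 : q'.1.2 = q.1.1 ∨ q'.1.2 = q.1.2 := by
      by_contra hc
      push Not at hc
      exact (hmem q'.1.2 hc.1 hc.2).2 rfl
    have hlt' : q'.1.1 < q'.1.2 := q'.2
    have hlt : q.1.1 < q.1.2 := q.2
    apply hq
    apply Subtype.ext
    apply Prod.ext
    · rcases h1 with h1 | h1
      · exact h1
      · rcases h2 with h2 | h2
        · exact absurd (h1 ▸ h2 ▸ hlt') (lt_asymm hlt)
        · exact absurd (h1.trans h2.symm) (ne_of_lt hlt')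
    · rcases h2 with h2 | h2
      · rcases h1 with h1 | h1
        · exact absurd (h1.trans h2.symm) (ne_of_lt hlt')
        · exact absurd (h1 ▸ h2 ▸ hlt') (lt_asymm hlt)
      · exact h2

/-- The single-plane twist twists exactly the stack `{x_μ = x_ν = -1}` of its plane: its insertion
`p ↦ z_p⁻¹` is the tree's `stackInsertion ζ⁻¹ q (-1) (-1)`. [cite: tHooft1979Flux, §2 eq. (2.5)] -/
theorem plaquetteTwist_mulSingle_inv {L : ℕ} (q : Plane d) (ζ : Subgroup.center G) (p : Plaquette d L) :
    (plaquetteTwist (Pi.mulSingle q ζ) p)⁻¹ = stackInsertion ((ζ : G)⁻¹) q (-1) (-1) p := by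
  classical
  obtain ⟨x, q'⟩ := p
  unfold plaquetteTwist IsCornerPlaquette stackInsertion
  dsimp only
  by_cases hq : q' = q
  · subst hq
    simp only [Pi.mulSingle_eq_same, true_and]
    split_ifs <;> simp
  · simp only [Pi.mulSingle_eq_of_ne hq, hq, false_and, if_false]
    split_ifs <;> simp

end Erase

/-! ## Partition functions: reduction to one plane, strict inequality for every non-trivial twist -/

section Strict

variable {d L N : ℕ} [NeZero d] [NeZero L] {G : Type*} [Group G] [TopologicalSpace G]
  [IsTopologicalGroup G] [CompactSpace G] [MeasurableSpace G] [BorelSpace G]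
  (ρ : G →* Matrix (Fin N) (Fin N) ℂ)

/-- **Erasing any list of directions does not decrease `Z`**. [cite: Kanazawa2008, §2 Lemma 2 eq. (17)] -/
theorem twistZ_le_twistZ_foldr_eraseDir (β : ℝ) (hL : Even L) (hρ : Continuous ρ) (z : Twist d G) (l : List (Fin d)) :
    TwistedSector.twistZ ρ z β L ≤ TwistedSector.twistZ ρ (l.foldr eraseDir z) β L := by
  induction l with
  | nil => simp
  | cons κ l ih =>
    rw [List.foldr_cons]
    exact ih.trans (twistZ_le_twistZ_eraseDir ρ β hL hρ κ _)

/-- ★ **Every twist sector is dominated by each of its one-plane sectors**: `Z_z ≤ Z_{mulSingle q z_q}` for every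
plane `q` (erase all other directions). [cite: Kanazawa2008, §2 Lemma 2 eq. (17)] [cite: tHooft1979Flux, §2 eqs. (2.5)–(2.6)] -/
theorem twistZ_le_twistZ_mulSingle (β : ℝ) (hL : Even L) (hρ : Continuous ρ) (z : Twist d G) (q : Plane d) :
    TwistedSector.twistZ ρ z β L ≤ TwistedSector.twistZ ρ (Pi.mulSingle q (z q)) β L := by
  rw [← foldr_eraseDir_eq_mulSingle z q]
  exact twistZ_le_twistZ_foldr_eraseDir ρ β hL hρ z _

omit [NeZero d] in
/-- **Dictionary**: the twist-tensor partition function of a one-plane twist is the tree's stack form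
`twistedPartitionFunction ρ β L ζ q` ('t Hooft's `W` with one non-zero `n_{μν}`; the stack may be placed anywhere and
`Z(ζ⁻¹) = Z(ζ)`). [cite: tHooft1979Flux, §2 eqs. (2.5)–(2.6)] -/
theorem twistZ_mulSingle (β : ℝ) (hρ : Continuous ρ) (q : Plane d) (ζ : Subgroup.center G) :
    TwistedSector.twistZ ρ (Pi.mulSingle q ζ) β L = twistedPartitionFunction ρ β L (ζ : G) q := by
  unfold TwistedSector.twistZ
  have h : (fun p : Plaquette d L => (plaquetteTwist (Pi.mulSingle q ζ) p)⁻¹) =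
      stackInsertion ((ζ : G)⁻¹) q (-1) (-1) := funext (plaquetteTwist_mulSingle_inv q ζ)
  rw [h, ← twistedPartitionFunctionAt_eq_inserted, twistedPartitionFunctionAt_eq ρ β (Subgroup.inv_mem _ ζ.2),
    twistedPartitionFunction_inv ρ β hρ ζ.2]

/-- ★★ **Strict inequality for EVERY non-trivial twist** (Tomboulis's Prop. IV.1 strict clause «for any nonvanishing β
on any finite lattice», there for one vortex; here all planes at once): on `(ℤ/Lℤ)^d`, `L = 2^(n+1)`, for every
compact `G`, continuous `ρ`, EVERY `β ≠ 0`, and every twist `z` having a plane `q` on which `ρ(z_q)` is a scalar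
`ω ≠ 1`, `|ω| = 1`: `Z_z(β) < Z_1(β)` — i.e. the free energy of the sector is STRICTLY positive.
[cite: Tomboulis2007Confinement, §4 Prop. IV.1 eq. (4.6) and the sentence following it] [cite: Kanazawa2008, §2 Lemma 2 eq. (17)] -/
theorem twistZ_lt_twistZ_one [NeZero N] (n : ℕ) (hL : L = 2 ^ (n + 1)) (hρ : Continuous ρ) {β : ℝ}
    (hβ : β ≠ 0) (z : Twist d G) (q : Plane d) {ω : ℂ}
    (hω : ρ (z q : G) = ω • (1 : Matrix (Fin N) (Fin N) ℂ)) (hω1 : ‖ω‖ = 1) (hne : ω ≠ 1) :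
    TwistedSector.twistZ ρ z β L < TwistedSector.twistZ ρ (1 : Twist d G) β L := by
  have hLe : Even L := ⟨2 ^ n, by rw [hL, pow_succ]; ring⟩
  calc TwistedSector.twistZ ρ z β L ≤ TwistedSector.twistZ ρ (Pi.mulSingle q (z q)) β L :=
        twistZ_le_twistZ_mulSingle ρ β hLe hρ z q
    _ = twistedPartitionFunction ρ β L (z q : G) q := twistZ_mulSingle ρ β hρ q (z q)
    _ < twistedPartitionFunction ρ β L 1 q :=
        twistedPartitionFunction_lt_untwisted_plane ρ n hL hρ hβ q (z q).2 hω hω1 hne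
    _ = TwistedSector.twistZ ρ (Pi.mulSingle q (1 : Subgroup.center G)) β L :=
        (twistZ_mulSingle ρ β hρ q 1).symm
    _ = TwistedSector.twistZ ρ (1 : Twist d G) β L := by rw [Pi.mulSingle_one]

/-- The ratio form: `Z_z/Z_1 < 1`, so `-log(Z_z/Z_1) > 0`. [cite: Tomboulis2007Confinement, §4 Prop. IV.1 eq. (4.6) and §6 eq. (6.1)] -/
theorem twistZ_div_lt_one [NeZero N] (n : ℕ) (hL : L = 2 ^ (n + 1)) (hρ : Continuous ρ) {β : ℝ}
    (hβ : β ≠ 0) (z : Twist d G) (q : Plane d) {ω : ℂ}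
    (hω : ρ (z q : G) = ω • (1 : Matrix (Fin N) (Fin N) ℂ)) (hω1 : ‖ω‖ = 1) (hne : ω ≠ 1) :
    TwistedSector.twistZ ρ z β L / TwistedSector.twistZ ρ (1 : Twist d G) β L < 1 :=
  (div_lt_one (TwistedSector.twistZ_pos ρ hρ (1 : Twist d G) β L)).2
    (twistZ_lt_twistZ_one ρ n hL hρ hβ z q hω hω1 hne)

/-- ★★ **`SU(N)`: every non-zero twist tensor has strictly positive free energy at every `β ≠ 0`** on the torus of side
`2^(n'+1)`: `W{n} < W{0}` whenever some `n_{μν} ≠ 0` in `ℤ/N`. [cite: Tomboulis2007Confinement, §4 Prop. IV.1 eq. (4.6) and the sentence following it] [cite: tHooft1979Flux, §2 eqs. (2.5)–(2.6)] -/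
theorem sun_twistZ_lt_untwisted (Ncol : ℕ) [NeZero Ncol] (n' : ℕ) (hL : L = 2 ^ (n' + 1)) {β : ℝ}
    (hβ : β ≠ 0) (m : Plane d → ZMod Ncol) (q : Plane d) (hq : m q ≠ 0) :
    TwistedSector.twistZ (fundamentalRep (Fin Ncol)) (twistOfTensor Ncol m) β L <
      TwistedSector.twistZ (fundamentalRep (Fin Ncol)) (1 : Twist d (Matrix.specialUnitaryGroup (Fin Ncol) ℂ)) β L :=
  twistZ_lt_twistZ_one (fundamentalRep (Fin Ncol)) n' hL (continuous_fundamentalRep (Fin Ncol)) hβ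
    (twistOfTensor Ncol m) q (ω := centerPhase Ncol (m q)) (coe_suCenter Ncol (m q)) (norm_centerPhase Ncol (m q))
    (centerPhase_ne_one' hq)
where
  /-- `ω^k ≠ 1` for `k ≠ 0` in `ℤ/N` (primitive root of unity; copy of the tree's private lemma). [folklore] -/
  centerPhase_ne_one' {Ncol : ℕ} [NeZero Ncol] {k : ZMod Ncol} (hk : k ≠ 0) : centerPhase Ncol k ≠ 1 := by
    have hprim := Complex.isPrimitiveRoot_exp Ncol (NeZero.ne Ncol)
    have hpow : centerPhase Ncol k = Complex.exp (2 * Real.pi * Complex.I / Ncol) ^ k.val := by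
      rw [← Complex.exp_nat_mul, centerPhase]
      congr 1
      push_cast
      ring
    rw [hpow, Ne, hprim.pow_eq_one_iff_dvd]
    exact fun hdvd => hk ((ZMod.val_eq_zero k).1 (Nat.eq_zero_of_dvd_of_lt hdvd (ZMod.val_lt k)))

end Strict

end MultiTwist

end

end Literature.MathematicalPhysics.QuantumFieldTheory
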